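import Literature.MathematicalPhysics.QuantumManyBody.GroundStateFeynmanKacPerronFrobenius
import HarnessLib

/-!
# Ground state of the Feynman–Kac semigroup, XII: the continuous ground-state function

Part of the proof of `GroundStateFeynmanKac` (Chung–Zhao, *From Brownian Motion to Schrödinger's
Equation* (1995), Thm 3.17 with §8.3).  From the Perron–Frobenius data of the compact,
positivity improving, self-adjoint operator `T_1 = e^{-H_N}` on `L²(Λ_L^N)`
(`fkL2_perronFrobenius`: `μ₀ = ‖T_1‖ > 0` is a simple eigenvalue with an a.e. positive unit
eigenvector `e`) we build the **continuous representative**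

  `φ₀(X) = μ₀⁻¹ (T_1 e⁺)(X) = μ₀⁻¹ E_X[w_1 e⁺(B_1)]`,   `e⁺ = max(e, 0)`,

defined EVERYWHERE through the path integral, and prove, for `φ₀` given by this formula
(hypothesis `hφ`), the Feynman–Kac properties of a ground state at energy `λ₀ = -log μ₀`:

* `φ₀ = e` a.e. on the box, `φ₀ ≥ 0`, `φ₀ = 0` off the open box, measurable, bounded,
  `∫ φ₀² = 1`, continuous and strictly positive on the open box;
* **eigen-relation everywhere** `(e^{-tH_N} φ₀)(X) = μ₀^t φ₀(X)` for all `t > 0` and ALL `X`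
  (semigroup law `fkReal_add_time`, `T_t e = μ₀^t e` from `coeff_eq_rpow`);
* **ground-state projection everywhere**: `μ₀^{-T} (e^{-TH_N} g)(X) → ⟨φ₀, g⟩ φ₀(X)` for every
  `g ∈ L²(Λ)` and all `X` (`tendsto_rpow_smul_semigroup` in `L²`, then the bounded evaluation
  functional `fkEval` after one more unit of time);
* the same two facts in the `[0, ∞]`-valued `fkSemigroup` form of `IsGroundStateFK`.

Bose symmetry, continuity up to the boundary and the identification `λ₀ = groundStateEnergy`
are treated in the sequel files.

## References

* K. L. Chung, Z. Zhao, *From Brownian Motion to Schrödinger's Equation*, Springer (1995),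
  Thm 3.17, §8.3. [cite: ChungZhao1995, Thm 3.17]
* J. Glimm, A. Jaffe, *Quantum Physics* (1987), Thms 3.3.2–3.3.3, (3.4.2). [folklore]
-/

noncomputable section

namespace Literature.MathematicalPhysics.QuantumManyBody.BoseGas

open MeasureTheory ProbabilityTheory Filter Set
open scoped ENNReal NNReal Topology InnerProductSpace

variable {N : ℕ}

section Witness

variable {v : ℝ → ℝ≥0∞} {C : ℝ≥0} {L : ℝ}

/-! ### The positive-part representative of an `L²(Λ)` class -/

/-- The positive-part representative `e⁺ = max(e, 0)` is measurable. [folklore] -/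
theorem measurable_posRep (e : Lp ℝ 2 (volume.restrict (boxN N L))) :
    Measurable fun Y => max ((e : Config N → ℝ) Y) 0 :=
  (measurable_coeFn_Lp e).max measurable_const

/-- `e⁺` has finite squared mass on the box. [folklore] -/
theorem setLIntegral_posRep_sq_ne_top (e : Lp ℝ 2 (volume.restrict (boxN N L))) :
    ∫⁻ Y in boxN N L, ‖max ((e : Config N → ℝ) Y) 0‖ₑ ^ (2 : ℝ) ≠ ⊤ := by
  refine ne_top_of_le_ne_top (setLIntegral_enorm_sq_ne_top e) (lintegral_mono fun Y => ?_)
  gcongr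
  rw [Real.enorm_eq_ofReal (le_max_right _ _), ← ofReal_norm, Real.norm_eq_abs]
  exact ENNReal.ofReal_le_ofReal (max_le (le_abs_self _) (abs_nonneg _))

/-- For a nonnegative class, `e⁺ = e` a.e. on the box. [folklore] -/
theorem posRep_ae_eq {e : Lp ℝ 2 (volume.restrict (boxN N L))} (he0 : 0 ≤ e) :
    (fun Y => max ((e : Config N → ℝ) Y) 0) =ᵐ[volume.restrict (boxN N L)] (e : Config N → ℝ) := by
  filter_upwards [(Lp.coeFn_nonneg e).2 he0] with Y hY
  exact max_eq_left hY

/-! ### The formula `φ₀ = μ₀⁻¹ T_1 e⁺` and its basic properties -/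

/-- `T_1 e⁺ = μ₀ e` a.e. on the box, for an eigenvector `e ≥ 0` of `T_1` with eigenvalue `μ₀`.
[folklore] -/
theorem fkReal_posRep_ae_eq (hv : Measurable v) {e : Lp ℝ 2 (volume.restrict (boxN N L))}
    (he0 : 0 ≤ e) {μ₀ : ℝ} (hTe : fkL2 v L 1 e = μ₀ • e) :
    fkReal v L 1 (fun Y => max ((e : Config N → ℝ) Y) 0) =ᵐ[volume.restrict (boxN N L)]
      fun Y => μ₀ * (e : Config N → ℝ) Y := by
  have h1 := fkL2_coeFn hv L one_pos e
  have h2 : (fkL2 v L 1 e : Config N → ℝ) =ᵐ[volume.restrict (boxN N L)]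
      fun Y => μ₀ * (e : Config N → ℝ) Y := by
    rw [hTe]
    filter_upwards [Lp.coeFn_smul μ₀ e] with Y hY
    rw [hY, Pi.smul_apply, smul_eq_mul]
  have h3 : ∀ Y, fkReal v L 1 (fun Z => max ((e : Config N → ℝ) Z) 0) Y =
      fkReal v L 1 (e : Config N → ℝ) Y := fun Y =>
    fkReal_congr_ae_restrict v L one_pos (posRep_ae_eq he0) Y
  filter_upwards [h1, h2] with Y hY1 hY2
  rw [h3 Y, ← hY1, hY2]

variable {e : Lp ℝ 2 (volume.restrict (boxN N L))} {φ : Config N → ℝ}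

/-- **`φ₀ = e` a.e. on the box.** [folklore] -/
theorem gs_ae_eq (hv : Measurable v) (he0 : 0 ≤ e) {μ₀ : ℝ} (hμ₀ : μ₀ ≠ 0)
    (hTe : fkL2 v L 1 e = μ₀ • e)
    (hφ : φ = fun X => μ₀⁻¹ * fkReal v L 1 (fun Y => max ((e : Config N → ℝ) Y) 0) X) :
    φ =ᵐ[volume.restrict (boxN N L)] (e : Config N → ℝ) := by
  filter_upwards [fkReal_posRep_ae_eq hv he0 hTe] with Y hY
  rw [hφ]
  simp only [hY]
  field_simp

/-- `φ₀` is measurable. [folklore] -/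
theorem measurable_gs (hv : Measurable v) {μ₀ : ℝ}
    (hφ : φ = fun X => μ₀⁻¹ * fkReal v L 1 (fun Y => max ((e : Config N → ℝ) Y) 0) X) :
    Measurable φ := by
  rw [hφ]
  exact (measurable_fkReal hv L 1 (measurable_posRep e)).const_mul _

/-- `φ₀ ≥ 0` (for `μ₀ ≥ 0`). [folklore] -/
theorem gs_nonneg {μ₀ : ℝ} (hμ₀ : 0 ≤ μ₀)
    (hφ : φ = fun X => μ₀⁻¹ * fkReal v L 1 (fun Y => max ((e : Config N → ℝ) Y) 0) X)
    (X : Config N) : 0 ≤ φ X := by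
  rw [hφ]
  exact mul_nonneg (inv_nonneg.2 hμ₀) (fkReal_nonneg v L 1 (fun Y => le_max_right _ _) X)

/-- `φ₀ = 0` off the open box. [folklore] -/
theorem gs_of_notMem {μ₀ : ℝ}
    (hφ : φ = fun X => μ₀⁻¹ * fkReal v L 1 (fun Y => max ((e : Config N → ℝ) Y) 0) X)
    {X : Config N} (hX : X ∉ boxN N L) : φ X = 0 := by
  rw [hφ]
  simp only [fkReal_of_notMem v zero_le_one _ hX, mul_zero]

/-- `φ₀` is bounded. [folklore] -/
theorem gs_bounded {μ₀ : ℝ}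
    (hφ : φ = fun X => μ₀⁻¹ * fkReal v L 1 (fun Y => max ((e : Config N → ℝ) Y) 0) X) :
    ∃ M : ℝ, ∀ X, |φ X| ≤ M := by
  set K : ℝ := ((∫⁻ Y in boxN N L, ‖max ((e : Config N → ℝ) Y) 0‖ₑ ^ (2 : ℝ)) ^ (1 / 2 : ℝ)).toReal
  have hK : (∫⁻ Y in boxN N L, ‖max ((e : Config N → ℝ) Y) 0‖ₑ ^ (2 : ℝ)) ^ (1 / 2 : ℝ) ≤
      ENNReal.ofReal K := by
    rw [ENNReal.ofReal_toReal]
    exact ENNReal.rpow_ne_top_of_nonneg (by norm_num) (setLIntegral_posRep_sq_ne_top e)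
  refine ⟨|μ₀⁻¹| * (((∏ _i : Fin N, ∏ _k : Fin 3,
      ENNReal.ofReal (Real.sqrt (2 * Real.pi * (2 * (1 : ℝ).toNNReal)))⁻¹) ^ (1 / 2 : ℝ)).toReal * K),
    fun X => ?_⟩
  rw [hφ]
  simp only [abs_mul]
  gcongr
  exact abs_fkReal_le_heatConst v L one_pos le_rfl (measurable_posRep e) ENNReal.toReal_nonneg hK X

/-- `φ₀` is continuous at every point of the open box (strong Feller property). [folklore] -/
theorem continuousAt_gs (hv : Measurable v) (hC : ∀ r, v r ≤ C) {μ₀ : ℝ}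
    (hφ : φ = fun X => μ₀⁻¹ * fkReal v L 1 (fun Y => max ((e : Config N → ℝ) Y) 0) X)
    {X : Config N} (hX : X ∈ boxN N L) : ContinuousAt φ X := by
  rw [hφ]
  exact continuousAt_const.mul (continuousAt_fkReal hv hC L one_pos (measurable_posRep e)
    (setLIntegral_posRep_sq_ne_top e) hX)

/-- `φ₀ > 0` on the open box (positivity improving), for a unit class `e ≥ 0` and `μ₀ > 0`.
[folklore] -/
theorem gs_pos (hv : Measurable v) (hC : ∀ r, v r ≤ C) (he1 : ‖e‖ = 1) (he0 : 0 ≤ e)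
    {μ₀ : ℝ} (hμ₀ : 0 < μ₀)
    (hφ : φ = fun X => μ₀⁻¹ * fkReal v L 1 (fun Y => max ((e : Config N → ℝ) Y) 0) X)
    {X : Config N} (hX : X ∈ boxN N L) : 0 < φ X := by
  rw [hφ]
  refine mul_pos (inv_pos.2 hμ₀) (fkReal_pos_of_nonneg hv hC one_pos (measurable_posRep e)
    (fun Y => le_max_right _ _) (setLIntegral_posRep_sq_ne_top e) ?_ hX)
  intro hae
  have : e = 0 := by
    rw [Lp.eq_zero_iff_ae_eq_zero]
    filter_upwards [hae, posRep_ae_eq he0] with Y h1 h2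
    rw [← h2, h1]
  rw [this, norm_zero] at he1
  exact zero_ne_one he1

/-- `∫ φ₀² = 1` (in the `[0, ∞]` form of `IsGroundStateFK.norm_eq`). [folklore] -/
theorem lintegral_gs_sq (hv : Measurable v) (he1 : ‖e‖ = 1) (he0 : 0 ≤ e) {μ₀ : ℝ} (hμ₀ : 0 < μ₀)
    (hTe : fkL2 v L 1 e = μ₀ • e)
    (hφ : φ = fun X => μ₀⁻¹ * fkReal v L 1 (fun Y => max ((e : Config N → ℝ) Y) 0) X) :
    ∫⁻ X, ENNReal.ofReal (φ X) ^ 2 = 1 := by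
  have hzero : ∀ X, X ∉ boxN N L → ENNReal.ofReal (φ X) ^ 2 = 0 := fun X hX => by
    rw [gs_of_notMem hφ hX]; simp
  rw [← setLIntegral_eq_of_support_subset (s := boxN N L) (fun X hX => by
    by_contra h; exact hX (hzero X h))]
  have hae : ∀ᵐ X ∂volume.restrict (boxN N L),
      ENNReal.ofReal (φ X) ^ 2 = ‖(e : Config N → ℝ) X‖ₑ ^ (2 : ℝ) := by
    filter_upwards [gs_ae_eq hv he0 hμ₀.ne' hTe hφ, (Lp.coeFn_nonneg e).2 he0] with X hX h0
    rw [hX, ← Real.enorm_eq_ofReal h0, ← ENNReal.rpow_two]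
  rw [lintegral_congr_ae hae]
  have h := ofReal_norm_Lp e
  rw [he1, ENNReal.ofReal_one] at h
  have h2 : ((∫⁻ Y in boxN N L, ‖(e : Config N → ℝ) Y‖ₑ ^ (2 : ℝ)) ^ (1 / 2 : ℝ)) ^ (2 : ℝ) = 1 := by
    rw [← h, ENNReal.one_rpow]
  rwa [← ENNReal.rpow_mul, show (1 / 2 : ℝ) * 2 = 1 by norm_num, ENNReal.rpow_one] at h2

end Witness

/-! ### The eigen-relation everywhere -/

section Eigen

variable {v : ℝ → ℝ≥0∞} {C : ℝ≥0} {L : ℝ} {e : Lp ℝ 2 (volume.restrict (boxN N L))}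
  {φ : Config N → ℝ}

/-- **`T_t e = μ₀^t e` for all `t > 0`** (`μ₀ = ‖T_1‖`), for the simple Perron–Frobenius
eigenvector of `T_1` (abstract spectral calculus of the compact self-adjoint contraction semigroup,
`coeff_eq_rpow`). [cite: ChungZhao1995, Thm 3.17] -/
theorem fkL2_apply_eigen (hv : Measurable v)
    (hT1 : fkL2 (N := N) v L 1 ≠ 0) (he1 : ‖e‖ = 1)
    (hTe : fkL2 v L 1 e = ‖fkL2 (N := N) v L 1‖ • e)
    (hsimple : ∀ f, fkL2 v L 1 f = ‖fkL2 (N := N) v L 1‖ • f → ∃ c : ℝ, f = c • e)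
    {t : ℝ} (ht : 0 < t) :
    fkL2 v L t e = (‖fkL2 (N := N) v L 1‖ ^ t) • e := by
  have hadd : ∀ s t : ℝ, 0 < s → 0 < t → fkL2 (N := N) v L (s + t) =
      (fkL2 v L s).comp (fkL2 v L t) := fun s t hs ht => fkL2_add_time hv L hs ht
  have hcontr : ∀ t : ℝ, 0 < t → ‖(fkL2 v L t :
      Lp ℝ 2 (volume.restrict (boxN N L)) →L[ℝ] Lp ℝ 2 (volume.restrict (boxN N L)))‖ ≤ 1 :=
    fun t _ => norm_fkL2_le_one v L t
  have hpos : ∀ t : ℝ, 0 < t → ∀ x : Lp ℝ 2 (volume.restrict (boxN N L)),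
      0 ≤ ⟪fkL2 v L t x, x⟫_ℝ := fun t ht x => inner_fkL2_self_nonneg hv L ht x
  have hμ₀ : 0 < ‖fkL2 (N := N) v L 1‖ := norm_pos_iff.2 hT1
  have h1 := semigroup_apply_eigenvector (S := fun t => fkL2 (N := N) v L t) hadd he1 hTe hsimple ht
  have h2 := coeff_eq_rpow (S := fun t => fkL2 (N := N) v L t) hadd hcontr hpos he1 hTe hsimple hμ₀ ht
  rw [h1, h2]

/-- `T_t e⁺ = μ₀^t e⁺` a.e. on the box (`t > 0`). [folklore] -/
theorem fkReal_posRep_ae_eq_rpow (hv : Measurable v)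
    (hT1 : fkL2 (N := N) v L 1 ≠ 0) (he1 : ‖e‖ = 1) (he0 : 0 ≤ e)
    (hTe : fkL2 v L 1 e = ‖fkL2 (N := N) v L 1‖ • e)
    (hsimple : ∀ f, fkL2 v L 1 f = ‖fkL2 (N := N) v L 1‖ • f → ∃ c : ℝ, f = c • e)
    {t : ℝ} (ht : 0 < t) :
    fkReal v L t (fun Y => max ((e : Config N → ℝ) Y) 0) =ᵐ[volume.restrict (boxN N L)]
      fun Y => ‖fkL2 (N := N) v L 1‖ ^ t * max ((e : Config N → ℝ) Y) 0 := by
  have h1 : ∀ Y, fkReal v L t (fun Z => max ((e : Config N → ℝ) Z) 0) Y =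
      fkReal v L t (e : Config N → ℝ) Y := fun Y =>
    fkReal_congr_ae_restrict v L ht (posRep_ae_eq he0) Y
  have h2 := fkL2_coeFn hv L ht e
  have h3 : (fkL2 v L t e : Config N → ℝ) =ᵐ[volume.restrict (boxN N L)]
      fun Y => ‖fkL2 (N := N) v L 1‖ ^ t * (e : Config N → ℝ) Y := by
    rw [fkL2_apply_eigen hv hT1 he1 hTe hsimple ht]
    filter_upwards [Lp.coeFn_smul (‖fkL2 (N := N) v L 1‖ ^ t) e] with Y hY
    rw [hY, Pi.smul_apply, smul_eq_mul]
  filter_upwards [h2, h3, posRep_ae_eq he0] with Y hY2 hY3 hYp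
  rw [h1 Y, ← hY2, hY3, hYp]

/-- **The eigen-relation holds EVERYWHERE for the continuous representative**:
`(e^{-tH_N} φ₀)(X) = μ₀^t φ₀(X)` for all `t > 0` and all `X` (semigroup law through time `1`:
`T_t φ₀ = μ₀⁻¹ T_1 (T_t e⁺)` and `T_t e⁺ = μ₀^t e⁺` a.e.). [cite: ChungZhao1995, Thm 3.17] -/
theorem fkReal_gs (hv : Measurable v)
    (hT1 : fkL2 (N := N) v L 1 ≠ 0) (he1 : ‖e‖ = 1) (he0 : 0 ≤ e)
    (hTe : fkL2 v L 1 e = ‖fkL2 (N := N) v L 1‖ • e)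
    (hsimple : ∀ f, fkL2 v L 1 f = ‖fkL2 (N := N) v L 1‖ • f → ∃ c : ℝ, f = c • e)
    (hφ : φ = fun X => ‖fkL2 (N := N) v L 1‖⁻¹ *
      fkReal v L 1 (fun Y => max ((e : Config N → ℝ) Y) 0) X)
    {t : ℝ} (ht : 0 < t) (X : Config N) :
    fkReal v L t φ X = ‖fkL2 (N := N) v L 1‖ ^ t * φ X := by
  set μ₀ : ℝ := ‖fkL2 (N := N) v L 1‖ with hμ₀def
  have hμ₀ : 0 < μ₀ := norm_pos_iff.2 hT1
  set ep : Config N → ℝ := fun Y => max ((e : Config N → ℝ) Y) 0 with hep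
  have hmeas : Measurable ep := measurable_posRep e
  have hfin : ∫⁻ Y in boxN N L, ‖ep Y‖ₑ ^ (2 : ℝ) ≠ ⊤ := setLIntegral_posRep_sq_ne_top e
  have hφ' : φ = μ₀⁻¹ • fkReal v L 1 ep := by rw [hφ]; rfl
  -- `fkReal t ep` has finite squared mass (it is `μ₀^t ep` a.e.)
  have hstep : fkReal v L t ep =ᵐ[volume.restrict (boxN N L)] fun Y => μ₀ ^ t * ep Y :=
    fkReal_posRep_ae_eq_rpow hv hT1 he1 he0 hTe hsimple ht
  calc fkReal v L t φ X = μ₀⁻¹ * fkReal v L t (fkReal v L 1 ep) X := by rw [hφ', fkReal_smul]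
    _ = μ₀⁻¹ * fkReal v L (t + 1) ep X := by rw [fkReal_add_time hv L ht one_pos hmeas hfin]
    _ = μ₀⁻¹ * fkReal v L (1 + t) ep X := by rw [add_comm]
    _ = μ₀⁻¹ * fkReal v L 1 (fkReal v L t ep) X := by rw [fkReal_add_time hv L one_pos ht hmeas hfin]
    _ = μ₀⁻¹ * fkReal v L 1 (fun Y => μ₀ ^ t * ep Y) X := by
        rw [fkReal_congr_ae_restrict v L one_pos hstep X]
    _ = μ₀⁻¹ * (μ₀ ^ t * fkReal v L 1 ep X) := by
        rw [show (fun Y => μ₀ ^ t * ep Y) = (μ₀ ^ t) • ep from rfl, fkReal_smul]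
    _ = μ₀ ^ t * φ X := by rw [hφ]; ring

/-! ### The ground-state projection everywhere -/

/-- **`μ₀^{-s} (e^{-sH_N} g)(X) → ⟨e, g⟩ φ₀(X)` as `s → ∞`, for every `g ∈ L²(Λ)` and ALL `X`**
(the `L²` asymptotics `tendsto_rpow_smul_semigroup` followed by the bounded evaluation functional
`g ↦ (e^{-H_N} g)(X)` after one more unit of time). [cite: ChungZhao1995, Thm 3.17] -/
theorem tendsto_fkReal_gs (hv : Measurable v) (hC : ∀ r, v r ≤ C) (hL : 0 < L)
    (hT1 : fkL2 (N := N) v L 1 ≠ 0) (he1 : ‖e‖ = 1) (he0 : 0 ≤ e)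
    (hTe : fkL2 v L 1 e = ‖fkL2 (N := N) v L 1‖ • e)
    (hsimple : ∀ f, fkL2 v L 1 f = ‖fkL2 (N := N) v L 1‖ • f → ∃ c : ℝ, f = c • e)
    (hφ : φ = fun X => ‖fkL2 (N := N) v L 1‖⁻¹ *
      fkReal v L 1 (fun Y => max ((e : Config N → ℝ) Y) 0) X)
    (G : Lp ℝ 2 (volume.restrict (boxN N L))) (X : Config N) :
    Tendsto (fun s : ℝ => ‖fkL2 (N := N) v L 1‖ ^ (-s) * fkReal v L s G X) atTop
      (𝓝 (⟪e, G⟫_ℝ * φ X)) := by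
  set μ₀ : ℝ := ‖fkL2 (N := N) v L 1‖ with hμ₀def
  have hμ₀ : 0 < μ₀ := norm_pos_iff.2 hT1
  have hadd : ∀ s t : ℝ, 0 < s → 0 < t → fkL2 (N := N) v L (s + t) =
      (fkL2 v L s).comp (fkL2 v L t) := fun s t hs ht => fkL2_add_time hv L hs ht
  have hcontr : ∀ t : ℝ, 0 < t → ‖(fkL2 v L t :
      Lp ℝ 2 (volume.restrict (boxN N L)) →L[ℝ] Lp ℝ 2 (volume.restrict (boxN N L)))‖ ≤ 1 :=
    fun t _ => norm_fkL2_le_one v L t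
  have hsym : ∀ t : ℝ, 0 < t → ∀ x y : Lp ℝ 2 (volume.restrict (boxN N L)),
      ⟪fkL2 v L t x, y⟫_ℝ = ⟪x, fkL2 v L t y⟫_ℝ := fun t ht x y => inner_fkL2_comm hv L ht x y
  have hpos : ∀ t : ℝ, 0 < t → ∀ x : Lp ℝ 2 (volume.restrict (boxN N L)),
      0 ≤ ⟪fkL2 v L t x, x⟫_ℝ := fun t ht x => inner_fkL2_self_nonneg hv L ht x
  have hc1 : IsCompactOperator (fkL2 v L 1 :
      Lp ℝ 2 (volume.restrict (boxN N L)) →L[ℝ] Lp ℝ 2 (volume.restrict (boxN N L))) :=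
    isCompactOperator_fkL2 hv hC hL one_pos
  have hL2 := tendsto_rpow_smul_semigroup (S := fun t => fkL2 (N := N) v L t) hadd hcontr hsym hpos
    hc1 hT1 he1 hTe hsimple G
  -- apply the evaluation functional at time `1`
  have hev := ((fkEval v L 1 X).continuous.tendsto _).comp hL2
  have hlim : fkEval v L 1 X (⟪e, G⟫_ℝ • e) = ⟪e, G⟫_ℝ * (μ₀ * φ X) := by
    rw [map_smul, smul_eq_mul, fkEval_apply hv L one_pos]
    congr 1
    rw [← fkReal_congr_ae_restrict v L one_pos (posRep_ae_eq he0) X]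
    simp only [hφ]
    rw [← mul_assoc, mul_inv_cancel₀ hμ₀.ne', one_mul]
  rw [hlim] at hev
  have hterm : ∀ t : ℝ, 0 < t → fkEval v L 1 X (μ₀ ^ (-t) • fkL2 v L t G) =
      μ₀ ^ (-t) * fkReal v L (1 + t) G X := by
    intro t ht
    rw [map_smul, smul_eq_mul, fkEval_apply hv L one_pos,
      fkReal_congr_ae_restrict v L one_pos (fkL2_coeFn hv L ht G) X,
      ← fkReal_add_time hv L one_pos ht (measurable_coeFn_Lp G) (setLIntegral_enorm_sq_ne_top G)]
  have hev' : Tendsto (fun t : ℝ => μ₀ ^ (-t) * fkReal v L (1 + t) G X) atTop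
      (𝓝 (⟪e, G⟫_ℝ * (μ₀ * φ X))) := by
    refine hev.congr' ?_
    filter_upwards [eventually_gt_atTop 0] with t ht
    exact hterm t ht
  -- multiply by `μ₀⁻¹` and reindex `s = t + 1`
  have hev'' : Tendsto (fun t : ℝ => μ₀ ^ (-(t + 1)) * fkReal v L (t + 1) G X) atTop
      (𝓝 (⟪e, G⟫_ℝ * φ X)) := by
    have h := hev'.const_mul μ₀⁻¹
    have hlimeq : μ₀⁻¹ * (⟪e, G⟫_ℝ * (μ₀ * φ X)) = ⟪e, G⟫_ℝ * φ X := by field_simp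
    rw [hlimeq] at h
    refine h.congr' (Eventually.of_forall fun t => ?_)
    have : μ₀ ^ (-(t + 1)) = μ₀⁻¹ * μ₀ ^ (-t) := by
      rw [neg_add, Real.rpow_add hμ₀, Real.rpow_neg_one, mul_comm]
    show μ₀⁻¹ * (μ₀ ^ (-t) * fkReal v L (1 + t) G X) = μ₀ ^ (-(t + 1)) * fkReal v L (t + 1) G X
    rw [this, add_comm t 1, mul_assoc]
  have hcomp := hev''.comp (tendsto_atTop_add_const_right atTop (-1) tendsto_id)
  refine hcomp.congr' (Eventually.of_forall fun s => ?_)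
  simp only [Function.comp_apply, id]
  rw [show s + -1 + 1 = s by ring]

/-! ### The two limits in the `[0, ∞]`-valued Feynman–Kac form -/

/-- **Eigen-relation in `fkSemigroup` form**: `e^{-TH_N}(φ₀)(X) = μ₀^T φ₀(X)` for all `T ≥ 0` and
all `X`. [cite: ChungZhao1995, Thm 3.17] -/
theorem fkSemigroup_gs (hv : Measurable v)
    (hT1 : fkL2 (N := N) v L 1 ≠ 0) (he1 : ‖e‖ = 1) (he0 : 0 ≤ e)
    (hTe : fkL2 v L 1 e = ‖fkL2 (N := N) v L 1‖ • e)
    (hsimple : ∀ f, fkL2 v L 1 f = ‖fkL2 (N := N) v L 1‖ • f → ∃ c : ℝ, f = c • e)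
    (hφ : φ = fun X => ‖fkL2 (N := N) v L 1‖⁻¹ *
      fkReal v L 1 (fun Y => max ((e : Config N → ℝ) Y) 0) X)
    {T : ℝ} (hT : 0 ≤ T) (X : Config N) :
    fkSemigroup v L T (fun Y => ENNReal.ofReal (φ Y)) X =
      ENNReal.ofReal (‖fkL2 (N := N) v L 1‖ ^ T * φ X) := by
  set μ₀ : ℝ := ‖fkL2 (N := N) v L 1‖ with hμ₀def
  have hμ₀ : 0 < μ₀ := norm_pos_iff.2 hT1
  have h0 : ∀ Y, 0 ≤ φ Y := gs_nonneg hμ₀.le hφ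
  rcases eq_or_lt_of_le hT with rfl | hTpos
  · rw [fkSemigroup_zero, Real.rpow_zero, one_mul]
    by_cases hX : X ∈ boxN N L
    · rw [indicator_of_mem hX]
    · rw [indicator_of_notMem hX, gs_of_notMem hφ hX, ENNReal.ofReal_zero]
  have hmeas : Measurable φ := measurable_gs hv hφ
  have hsq : ∫⁻ Y, (fun Y => ENNReal.ofReal (φ Y)) Y ^ (2 : ℝ) ≠ ⊤ := by
    have h1 := lintegral_gs_sq hv he1 he0 hμ₀ hTe hφ
    have : (fun Y => ENNReal.ofReal (φ Y) ^ (2 : ℝ)) = fun Y => ENNReal.ofReal (φ Y) ^ 2 := by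
      funext Y; rw [ENNReal.rpow_two]
    simp only [this, h1]
    exact ENNReal.one_ne_top
  have hfin := fkSemigroup_lt_top v L hTpos hmeas.ennreal_ofReal hsq X
  rw [← fkReal_gs hv hT1 he1 he0 hTe hsimple hφ hTpos X,
    fkReal_eq_toReal_fkSemigroup hv L T hmeas h0 X, ENNReal.ofReal_toReal hfin.ne]

end Eigen

/-! ### The ground-state projection in `fkSemigroup` form -/

section Projection

variable {v : ℝ → ℝ≥0∞} {C : ℝ≥0} {L : ℝ} {e : Lp ℝ 2 (volume.restrict (boxN N L))}
  {φ : Config N → ℝ}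

/-- `∫ φ₀ g < ∞` for `g` with `∫ g² < ∞` (`φ₀` is bounded and lives on the finite box).
[folklore] -/
theorem lintegral_gs_mul_ne_top {M : ℝ} (hM : ∀ X, |φ X| ≤ M)
    (hzero : ∀ X, X ∉ boxN N L → φ X = 0) {g : Config N → ℝ≥0∞}
    (hg2 : ∫⁻ Y, g Y ^ 2 ≠ ⊤) : ∫⁻ Y, ENNReal.ofReal (φ Y) * g Y ≠ ⊤ := by
  -- `a ≤ 1 + a²` in `[0, ∞]`
  have le_one_add_sq : ∀ a : ℝ≥0∞, a ≤ 1 + a ^ 2 := fun a => by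
    rcases le_or_gt a 1 with h | h
    · exact h.trans le_self_add
    · calc a = a * 1 := (mul_one a).symm
        _ ≤ a * a := by gcongr
        _ = a ^ 2 := (sq a).symm
        _ ≤ 1 + a ^ 2 := le_add_self
  have hpt : ∀ Y, ENNReal.ofReal (φ Y) * g Y ≤
      (boxN N L).indicator (fun Y => ENNReal.ofReal M * (1 + g Y ^ 2)) Y := by
    intro Y
    by_cases hY : Y ∈ boxN N L
    · rw [indicator_of_mem hY]
      exact mul_le_mul' (ENNReal.ofReal_le_ofReal ((le_abs_self _).trans (hM Y)))
        (le_one_add_sq _)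
    · rw [indicator_of_notMem hY, hzero Y hY]; simp
  refine ne_top_of_le_ne_top ?_ (lintegral_mono hpt)
  rw [lintegral_indicator (measurableSet_boxN N L), lintegral_const_mul' _ _ ENNReal.ofReal_ne_top,
    lintegral_add_left measurable_const, setLIntegral_const, one_mul]
  refine ENNReal.mul_ne_top ENNReal.ofReal_ne_top (ENNReal.add_ne_top.2 ⟨(volume_boxN_lt_top N L).ne,
    ne_top_of_le_ne_top hg2 (lintegral_mono' (Measure.restrict_le_self (s := boxN N L)) le_rfl)⟩)

/-- **Ground-state projection in `fkSemigroup` form**: for measurable `g ≥ 0` with `∫ g² < ∞`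
and every `X`, `μ₀^{-T} (e^{-TH_N} g)(X) → (∫ φ₀ g) φ₀(X)` as `T → ∞`.
[cite: ChungZhao1995, Thm 3.17] -/
theorem tendsto_fkSemigroup_gs (hv : Measurable v) (hC : ∀ r, v r ≤ C) (hL : 0 < L)
    (hT1 : fkL2 (N := N) v L 1 ≠ 0) (he1 : ‖e‖ = 1) (he0 : 0 ≤ e)
    (hTe : fkL2 v L 1 e = ‖fkL2 (N := N) v L 1‖ • e)
    (hsimple : ∀ f, fkL2 v L 1 f = ‖fkL2 (N := N) v L 1‖ • f → ∃ c : ℝ, f = c • e)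
    (hφ : φ = fun X => ‖fkL2 (N := N) v L 1‖⁻¹ *
      fkReal v L 1 (fun Y => max ((e : Config N → ℝ) Y) 0) X)
    {g : Config N → ℝ≥0∞} (hg : Measurable g) (hg2 : ∫⁻ Y, g Y ^ 2 ≠ ⊤) (X : Config N) :
    Tendsto (fun T : ℝ => ENNReal.ofReal (‖fkL2 (N := N) v L 1‖ ^ (-T)) * fkSemigroup v L T g X)
      atTop (𝓝 ((∫⁻ Y, ENNReal.ofReal (φ Y) * g Y) * ENNReal.ofReal (φ X))) := by
  set μ₀ : ℝ := ‖fkL2 (N := N) v L 1‖ with hμ₀def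
  have hμ₀ : 0 < μ₀ := norm_pos_iff.2 hT1
  have hmeasφ : Measurable φ := measurable_gs hv hφ
  have h0φ : ∀ Y, 0 ≤ φ Y := gs_nonneg hμ₀.le hφ
  obtain ⟨M, hM⟩ := gs_bounded hφ
  -- the real version of `g`
  set gr : Config N → ℝ := fun Y => (g Y).toReal with hgrdef
  have hgr : Measurable gr := hg.ennreal_toReal
  have hgr0 : ∀ Y, 0 ≤ gr Y := fun Y => ENNReal.toReal_nonneg
  have hlt : ∀ᵐ Y ∂(volume : Measure (Config N)), g Y < ⊤ := by
    have h2 : ∀ᵐ Y ∂(volume : Measure (Config N)), g Y ^ 2 < ⊤ := ae_lt_top (hg.pow_const 2) hg2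
    filter_upwards [h2] with Y hY
    by_contra htop
    rw [not_lt, top_le_iff] at htop
    rw [htop, ENNReal.top_pow two_ne_zero] at hY
    exact lt_irrefl _ hY
  have hae : g =ᵐ[volume] fun Y => ENNReal.ofReal (gr Y) := by
    filter_upwards [hlt] with Y hY
    rw [ENNReal.ofReal_toReal hY.ne]
  have hle : ∀ Y, ‖gr Y‖ₑ ^ (2 : ℝ) ≤ g Y ^ 2 := fun Y => by
    rw [ENNReal.rpow_two, Real.enorm_eq_ofReal (hgr0 Y)]
    gcongr
    exact ENNReal.ofReal_toReal_le
  have hgr2 : ∫⁻ Y in boxN N L, ‖gr Y‖ₑ ^ (2 : ℝ) ≠ ⊤ :=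
    ne_top_of_le_ne_top hg2 ((lintegral_mono' Measure.restrict_le_self le_rfl).trans
      (lintegral_mono hle))
  have hmem : MemLp gr 2 (volume.restrict (boxN N L)) := by
    refine ⟨hgr.aestronglyMeasurable, ?_⟩
    rw [eLpNorm_two_eq]
    exact ENNReal.rpow_lt_top_of_nonneg (by norm_num) hgr2
  set G : Lp ℝ 2 (volume.restrict (boxN N L)) := hmem.toLp gr with hGdef
  have hG : (G : Config N → ℝ) =ᵐ[volume.restrict (boxN N L)] gr := hmem.coeFn_toLp
  -- the real limit
  have hreal := tendsto_fkReal_gs hv hC hL hT1 he1 he0 hTe hsimple hφ G X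
  -- `fkSemigroup T g X = ofReal (fkReal T G X)` for `T > 0`
  have hsq' : ∫⁻ Y, (fun Y => ENNReal.ofReal (gr Y)) Y ^ (2 : ℝ) ≠ ⊤ := by
    refine ne_top_of_le_ne_top hg2 (lintegral_mono fun Y => ?_)
    simp only
    rw [← Real.enorm_eq_ofReal (hgr0 Y)]
    exact hle Y
  have hterm : ∀ T : ℝ, 0 < T → fkSemigroup v L T g X = ENNReal.ofReal (fkReal v L T G X) := by
    intro T hT
    rw [fkSemigroup_congr_ae v L hT hae X, fkReal_congr_ae_restrict v L hT hG X,
      fkReal_eq_toReal_fkSemigroup hv L T hgr hgr0 X,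
      ENNReal.ofReal_toReal (fkSemigroup_lt_top v L hT hgr.ennreal_ofReal hsq' X).ne]
  have h1 : Tendsto (fun T : ℝ => ENNReal.ofReal (μ₀ ^ (-T) * fkReal v L T G X)) atTop
      (𝓝 (ENNReal.ofReal (⟪e, G⟫_ℝ * φ X))) := ENNReal.tendsto_ofReal hreal
  have h2 : (fun T : ℝ => ENNReal.ofReal (μ₀ ^ (-T) * fkReal v L T G X)) =ᶠ[atTop]
      fun T => ENNReal.ofReal (μ₀ ^ (-T)) * fkSemigroup v L T g X := by
    filter_upwards [eventually_gt_atTop 0] with T hT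
    rw [hterm T hT, ENNReal.ofReal_mul (Real.rpow_nonneg hμ₀.le _)]
  -- identify the limit
  have hI_top : ∫⁻ Y, ENNReal.ofReal (φ Y) * g Y ≠ ⊤ :=
    lintegral_gs_mul_ne_top hM (fun Y hY => gs_of_notMem hφ hY) hg2
  have hinner : ⟪e, G⟫_ℝ = (∫⁻ Y, ENNReal.ofReal (φ Y) * g Y).toReal := by
    rw [L2.inner_def]
    have h3 : ∫ a, ⟪(e : Config N → ℝ) a, (G : Config N → ℝ) a⟫_ℝ ∂volume.restrict (boxN N L) =
        ∫ a in boxN N L, gr a * φ a := by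
      refine integral_congr_ae ?_
      filter_upwards [hG, gs_ae_eq hv he0 hμ₀.ne' hTe hφ] with a ha hφa
      rw [RCLike.inner_apply, conj_trivial, ha, ← hφa]
    rw [h3, setIntegral_eq_integral_of_forall_compl_eq_zero (fun a ha => by
      rw [gs_of_notMem hφ ha, mul_zero]), integral_eq_lintegral_of_nonneg_ae
      (Eventually.of_forall fun a => mul_nonneg (hgr0 a) (h0φ a))
      ((hgr.mul hmeasφ).aestronglyMeasurable)]
    congr 1
    refine lintegral_congr_ae ?_
    filter_upwards [hae] with a ha
    rw [ENNReal.ofReal_mul (hgr0 a), ha, mul_comm]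
  have hlimeq : ENNReal.ofReal (⟪e, G⟫_ℝ * φ X) =
      (∫⁻ Y, ENNReal.ofReal (φ Y) * g Y) * ENNReal.ofReal (φ X) := by
    rw [ENNReal.ofReal_mul (by rw [hinner]; exact ENNReal.toReal_nonneg), hinner,
      ENNReal.ofReal_toReal hI_top]
  rw [← hlimeq]
  exact h1.congr' h2

end Projection

end Literature.MathematicalPhysics.QuantumManyBody.BoseGas
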